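import Literature.Algebra.Lie.ChevalleyEilenbergDirectSum
import HarnessLib

/-!
# Injective module maps on Chevalley–Eilenberg cochains: lifting cochains with values in the image,
# and reflection of non-coboundaries

Topic `Algebra/Lie`; namespace `Literature.Algebra.Lie.ChevalleyEilenberg` (the vocabulary of
`ChevalleyEilenbergComplex` / `ChevalleyEilenbergFunctoriality` / `ChevalleyEilenbergDirectSum`: cochains
`Cochain R L M q`, the cochain maps `map L φ q = φ_*` of a morphism of `L`-modules `φ : M → M'`, relative
complexes `Subcomplex.gK R L M K A` of pair actions).  Definitions with bodies and theorems only (no named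
fact, no `sorry`).

For an INJECTIVE morphism of `L`-modules `φ : M → M'`:

* `map_injective` — `φ_* : C^q(L; M) → C^q(L; M')` is injective;
* `liftCochain`, `map_liftCochain` — a cochain of `M'` all of whose values lie in `φ(M)` is `φ_* g` for a
  (unique) cochain `g` of `M`;
* `mem_gK_of_map_mem_gK` — **`φ_*` reflects membership in the `(𝔤, K)`-complexes** of pair actions
  intertwined by `φ` (`θ_x`, `i_x` and the group action commute with `φ_*`, which is injective);
* `d_ne_map_of_not_mem_coboundaries` — hence **`φ_*` reflects non-coboundaries relative to its image**: if
  `z ∈ C^{q+1}(L, K; M)^Γ` is not a coboundary of that complex, then `φ_* z` is not the coboundary `dβ` of any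
  cochain `β` of the `(𝔤, K)`-complex of `M'` with values in `φ(M)`;
* `Subcomplex.exists_not_mem_coboundaries_of_ne_zero`, `Subcomplex.toCohomology_ne_zero_of_not_mem_coboundaries`
  — non-zero classes of `H^q(S)` ↔ cocycles which are not coboundaries (the dictionary used by the automorphic
  apex files); `Subcomplex.IsCochainMapTo.not_mem_coboundaries_of_leftInverse` — split monomorphisms of
  complexes (`G ∘ F = id`) reflect coboundaries.

This is the mechanism by which a non-zero `(𝔤, K_∞)`-cohomology class of a submodule `V ↪ W` of automorphic
forms (e.g. the `K(𝔫)`-invariants `W^{K(𝔫)} ≅ π_∞ ⊗ π_f^{K(𝔫)}`) yields a cocycle with values in `W` which is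
not the coboundary of a cochain with values in `V` [cite: BorelWallach2000, I §5.1]
(`NumberTheory/Automorphic/ResGLnCuspidalCohomologyApexModule`).

## References

* A. Borel, N. Wallach, *Continuous cohomology, discrete subgroups, and representations of reductive
  groups*, 2nd ed., AMS (2000), I §1.2, I §5.1. [BorelWallach2000]
-/

open Fin Function

namespace Literature.Algebra.Lie.ChevalleyEilenberg

variable {R : Type*} [CommRing R] {L : Type*} [LieRing L] [LieAlgebra R L]
  {M : Type*} [AddCommGroup M] [Module R M] {M' : Type*} [AddCommGroup M'] [Module R M']
  [LieRingModule L M] [LieRingModule L M'] (φ : M →ₗ⁅R,L⁆ M')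

/-! ### Injectivity of `φ_*` and lifting of cochains with values in `φ(M)` -/

section Lift

/-- **`φ_*` is injective for an injective `φ`.** [folklore] -/
theorem map_injective (hφ : Injective φ) (q : ℕ) : Injective (map L φ q) := by
  intro f g h
  refine AlternatingMap.ext fun v => hφ ?_
  have hv := congrArg (fun k : Cochain R L M' q => k v) h
  simpa only [map_apply] using hv

/-- The lift through `φ_*` of a cochain of `M'` with values in `φ(M)` (`φ` injective). [folklore] -/
noncomputable def liftCochain (hφ : Injective φ) (q : ℕ) (f : Cochain R L M' q)
    (hf : ∀ v, f v ∈ LinearMap.range (φ : M →ₗ[R] M')) : Cochain R L M q :=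
  ((LinearEquiv.ofInjective (φ : M →ₗ[R] M') hφ).symm : LinearMap.range (φ : M →ₗ[R] M') →ₗ[R] M).compAlternatingMap
    (f.codRestrict (LinearMap.range (φ : M →ₗ[R] M')) hf)

/-- `φ_* (lift f) = f`. [folklore] -/
theorem map_liftCochain (hφ : Injective φ) (q : ℕ) (f : Cochain R L M' q)
    (hf : ∀ v, f v ∈ LinearMap.range (φ : M →ₗ[R] M')) : map L φ q (liftCochain φ hφ q f hf) = f := by
  refine AlternatingMap.ext fun v => ?_
  rw [map_apply]
  exact LinearEquiv.ofInjective_symm_apply (f := (φ : M →ₗ[R] M')) (h := hφ) ⟨f v, hf v⟩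

/-- **A cochain with values in `φ(M)` is in the image of `φ_*`.** [folklore] -/
theorem exists_map_eq (hφ : Injective φ) (q : ℕ) (f : Cochain R L M' q)
    (hf : ∀ v, f v ∈ LinearMap.range (φ : M →ₗ[R] M')) : ∃ g : Cochain R L M q, map L φ q g = f :=
  ⟨liftCochain φ hφ q f hf, map_liftCochain φ hφ q f hf⟩

end Lift

/-! ### `φ_*` reflects the `(𝔤, K)`-complex and non-coboundaries -/

section Reflect

variable [LieModule R L M] [LieModule R L M'] {Γ : Type*} [Group Γ]

/-- `φ_*` reflects the relative cochains of a Lie subalgebra (`θ_x φ_* = φ_* θ_x`, `i_x φ_* = φ_* i_x`,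
`φ_*` injective). [cite: BorelWallach2000, I §1.2] -/
theorem mem_rel_of_map_mem_rel (hφ : Injective φ) (K : LieSubalgebra R L) (q : ℕ) (f : Cochain R L M q)
    (hf : map L φ q f ∈ (Subcomplex.rel R L M' K).carrier q) : f ∈ (Subcomplex.rel R L M K).carrier q := by
  cases q with
  | zero =>
    rw [Subcomplex.mem_rel_zero_iff] at hf ⊢
    intro x hx
    refine map_injective φ hφ 0 ?_
    rw [← lieDer_map, hf x hx, map_zero]
  | succ q =>
    rw [Subcomplex.mem_rel_succ_iff] at hf ⊢
    intro x hx
    refine ⟨map_injective φ hφ (q + 1) ?_, map_injective φ hφ q ?_⟩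
    · rw [← lieDer_map, (hf x hx).1, map_zero]
    · rw [← ins_map, (hf x hx).2, map_zero]

/-- **`φ_*` reflects membership in the `(𝔤, K)`-complexes** of two pair actions with the same action on `L`
intertwined by the injective `φ`. [cite: BorelWallach2000, I §5.1] -/
theorem mem_gK_of_map_mem_gK (hφ : Injective φ) (K : LieSubalgebra R L) (A : PairAction R L M Γ)
    (A' : PairAction R L M' Γ) (hσ : ∀ g, A.σ g = A'.σ g) (hτ : ∀ g m, φ (A.τ g m) = A'.τ g (φ m)) (q : ℕ)
    (f : Cochain R L M q) (hf : map L φ q f ∈ (Subcomplex.gK R L M' K A').carrier q) :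
    f ∈ (Subcomplex.gK R L M K A).carrier q := by
  rw [Subcomplex.mem_gK_iff] at hf ⊢
  refine ⟨mem_rel_of_map_mem_rel φ hφ K q f hf.1, fun g => map_injective φ hφ q ?_⟩
  rw [← PairAction.act_map_of_comm A A' φ hσ hτ, hf.2 g]

/-- **`φ_*` reflects non-coboundaries relative to its image.**  Let `φ : M → M'` be an injective morphism
of `L`-modules intertwining two pair actions with the same action on `L`, and let `z ∈ C^{q+1}(L; M)` NOT be
a coboundary of the `(𝔤, K)`-complex of `M`.  Then `φ_* z` is not the coboundary `dβ` of any cochain `β`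
of the `(𝔤, K)`-complex of `M'` all of whose values lie in `φ(M)`: such a `β` is `φ_* γ` with `γ` in the
`(𝔤, K)`-complex of `M`, and `φ_* (dγ) = d(φ_* γ) = φ_* z` would give `dγ = z`.
[cite: BorelWallach2000, I §5.1] -/
theorem d_ne_map_of_not_mem_coboundaries (hφ : Injective φ) (K : LieSubalgebra R L)
    (A : PairAction R L M Γ) (A' : PairAction R L M' Γ) (hσ : ∀ g, A.σ g = A'.σ g)
    (hτ : ∀ g m, φ (A.τ g m) = A'.τ g (φ m)) {q : ℕ} {z : Cochain R L M (q + 1)}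
    (hz : z ∉ (Subcomplex.gK R L M K A).coboundaries (q + 1)) {β : Cochain R L M' q}
    (hβ : β ∈ (Subcomplex.gK R L M' K A').carrier q) (hβφ : ∀ v, β v ∈ LinearMap.range (φ : M →ₗ[R] M')) :
    d R L M' q β ≠ map L φ (q + 1) z := by
  obtain ⟨γ, rfl⟩ := exists_map_eq φ hφ q β hβφ
  intro hd
  rw [d_map] at hd
  have hγ : γ ∈ (Subcomplex.gK R L M K A).carrier q := mem_gK_of_map_mem_gK φ hφ K A A' hσ hτ q γ hβ
  exact hz (((Subcomplex.gK R L M K A).mem_coboundaries_succ_iff q z).2 ⟨γ, hγ, map_injective φ hφ (q + 1) hd⟩)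

/-- The forward direction for comparison: `φ_*` is a cochain map of the `(𝔤, K)`-complexes, so it carries
cocycles to cocycles (`ChevalleyEilenbergDirectSum`). [cite: BorelWallach2000, I §5.1] -/
theorem map_mem_cocycles_gK (K : LieSubalgebra R L) (A : PairAction R L M Γ) (A' : PairAction R L M' Γ)
    (hσ : ∀ g, A.σ g = A'.σ g) (hτ : ∀ g m, φ (A.τ g m) = A'.τ g (φ m)) (q : ℕ) (z : Cochain R L M q)
    (hz : z ∈ (Subcomplex.gK R L M K A).cocycles q) : map L φ q z ∈ (Subcomplex.gK R L M' K A').cocycles q :=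
  (Subcomplex.isCochainMapTo_gK_map_of_comm K A A' φ hσ hτ).mapsTo_cocycles q z hz

end Reflect

/-! ### Non-zero classes and non-coboundaries -/

section Classes

variable [LieModule R L M]

/-- **A non-zero class of `H^q(S)` is represented by a cocycle which is not a coboundary.** [folklore] -/
theorem Subcomplex.exists_not_mem_coboundaries_of_ne_zero (S : Subcomplex R L M) (q : ℕ) (c : S.Cohomology q)
    (hc : c ≠ 0) : ∃ z : Cochain R L M q, z ∈ S.cocycles q ∧ z ∉ S.coboundaries q := by
  obtain ⟨z, rfl⟩ := S.toCohomology_surjective q c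
  exact ⟨z, z.2, fun h => hc ((S.toCohomology_eq_zero_iff q z).2 h)⟩

/-- Conversely, the class of a cocycle which is not a coboundary is non-zero. [folklore] -/
theorem Subcomplex.toCohomology_ne_zero_of_not_mem_coboundaries (S : Subcomplex R L M) (q : ℕ) (z : Cochain R L M q)
    (hz : z ∈ S.cocycles q) (hz' : z ∉ S.coboundaries q) : S.toCohomology q ⟨z, hz⟩ ≠ 0 :=
  fun h => hz' ((S.toCohomology_eq_zero_iff q ⟨z, hz⟩).1 h)

/-- **Split monomorphisms of complexes reflect coboundaries**: if `G : T → S` is a cochain map and `F` a family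
of maps with `G ∘ F = id`, a cochain which is not a coboundary of `S` is mapped by `F` to a cochain which is not a
coboundary of `T` (`G` carries coboundaries to coboundaries). [folklore] -/
theorem Subcomplex.IsCochainMapTo.not_mem_coboundaries_of_leftInverse {L' : Type*} [LieRing L'] [LieAlgebra R L']
    {M'' : Type*} [AddCommGroup M''] [Module R M''] [LieRingModule L' M''] [LieModule R L' M'']
    {S : Subcomplex R L M} {T : Subcomplex R L' M''} {G : (q : ℕ) → Cochain R L' M'' q →ₗ[R] Cochain R L M q}
    (hG : T.IsCochainMapTo S G) (F : (q : ℕ) → Cochain R L M q →ₗ[R] Cochain R L' M'' q)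
    (hGF : ∀ (q : ℕ) (f : Cochain R L M q), G q (F q f) = f) {q : ℕ}
    {z : Cochain R L M q} (hz : z ∉ S.coboundaries q) : F q z ∉ T.coboundaries q := fun h => by
  have h' := hG.mapsTo_coboundaries q _ h
  rw [hGF] at h'
  exact hz h'

end Classes

end Literature.Algebra.Lie.ChevalleyEilenberg
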